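import Mathlib
import Literature.Computability.AlgebraicComplexity.FixedPointLog
import Summits.RiemannHypothesis.RiemannHypothesis.Theorems.WeilFormatCJointShiftSOS
import Summits.RiemannHypothesis.RiemannHypothesis.Theorems.WeilFormatCJointShiftCert
import Summits.RiemannHypothesis.RiemannHypothesis.Theorems.WeilFormatCJointShiftCertBrackets
import HarnessLib

/-!
# Joint-phantom shift certificate: SOUNDNESS of the kernel checker

Helper file (`--supports stmt-RiemannHypothesis-0098`), RH-free; seat rh-explicit-weil-1.  For a certificate `c`
(`WeilFormatCJointShiftCert.lean`) with `c.check = true` and `c.checkPart k = true` for every `k < c.nparts`: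

* `JointSOS.Cert.sound_real` — for every `a ≤ c.aQ` and every real measurable bounded `f` vanishing off `[−a, a]`,
  **`Σ_{(j,e,·) ∈ c.witems} 2·(log p_j/√(p_j^e)) · ∫ f(x − e log p_j) f(x) dx ≤ c.D · ∫ f²`.**

Proof: the table of part `k` has value `W_k + triSum_k` (`val_table`: window items + upper-triangular pair pass
with canonical classes); each table is bounded by its claimed `dparts[k] · ∫ f²` (`val_le_tableBound`, from the
brackets of `WeilFormatCJointShiftCertBrackets.lean` and `|I_f| ≤ I_f(0)`); summing over the parts restores the
window sum and — by symmetric completion (`triangle_eq_double`) and the vanishing of admissible correlations —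
the FULL Gram pair sum, which is `≥ 0` by the transfer principle `WeilFormatC.shiftCorr_gram_nonneg`
(`WeilFormatCJointShiftSOS.lean`, instantiated in `pairSum_nonneg`).  Standard axioms only.
-/

set_option linter.dupNamespace false

noncomputable section

namespace Summit.RiemannHypothesis.RiemannHypothesis.Theorems.WeilFormatC

namespace JointSOS

open MeasureTheory Set Finset
open scoped Real BigOperators
open Literature.Computability.AlgebraicComplexity

namespace Cert

variable {c : Cert}


/-! ### Semantics of the table of one part -/

section Table

variable (c) (f : ℝ → ℝ) (k : ℕ)

/-- `wsum_append` (see the module docstring). [folklore] -/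
theorem wsum_append (ws ws' : List WItem) : c.wsum (ws ++ ws') = c.wsum ws + c.wsum ws' := by
  induction ws with
  | nil => simp [wsum]
  | cons w rest ih => simp only [List.cons_append, wsum, ih]; ring

/-- `ins` adds one term. -/
theorem val_ins (γ : ZVec4) (v : ℤ) (ws : List WItem) (L : List Entry) :
    c.val f (ins γ v ws L) =
      c.val f L + ((v : ℝ) / (4 : ℝ) ^ c.kbits + 2 * c.wsum ws) * (∫ x, f (x - c.phi γ) * f x) := by
  induction L with
  | nil => simp only [ins, val]; ring
  | cons en rest ih =>
      obtain ⟨γ', v', ws'⟩ := en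
      simp only [ins]
      by_cases h : γ = γ'
      · subst h
        simp only [if_true, val, wsum_append]; push_cast; ring
      · simp only [if_neg h, val, ih]; ring

/-- The window items of part `k` contribute `Σ_{w in part k} 2 wt(w) X(e·unit j)`. -/
theorem val_windowEntries (W : List WItem) (acc : List Entry) :
    c.val f (c.windowEntries k W acc) = c.val f acc +
      (W.map fun w ↦ if c.partOf (uvec w.1 w.2.1) = k then
        2 * c.wt w * ∫ x, f (x - c.phi (uvec w.1 w.2.1)) * f x else 0).sum := by
  induction W generalizing acc with
  | nil => simp [windowEntries]
  | cons w rest ih =>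
      simp only [windowEntries, ih, List.map_cons, List.sum_cons]
      by_cases h : c.partOf (uvec w.1 w.2.1) = k
      · rw [if_pos h, if_pos h, val_ins]; simp only [wsum]; push_cast; ring
      · rw [if_neg h, if_neg h]; ring

/-- The pair term of part `k`. -/
def pairTerm (sα : ZVec4) (cα : List ℤ) (sc : ZVec4 × List ℤ) : ℝ :=
  if c.adm (canon (vsub sc.1 sα)) then 0 else
    if c.partOf (canon (vsub sc.1 sα)) = k then
      (2 * dotZ cα sc.2 : ℤ) / (4 : ℝ) ^ c.kbits * ∫ x, f (x - c.phi (canon (vsub sc.1 sα))) * f x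
    else 0

/-- The diagonal term of part `k`. -/
def diagTerm (cα : List ℤ) : ℝ :=
  if c.partOf (0, 0, 0, 0) = k then (dotZ cα cα : ℝ) / (4 : ℝ) ^ c.kbits * ∫ x, f (x - c.phi (0, 0, 0, 0)) * f x
  else 0

/-- `val_step` (see the module docstring). [folklore] -/
theorem val_step (sα : ZVec4) (cα : List ℤ) (sc : ZVec4 × List ℤ) (acc : List Entry) :
    c.val f (c.step k sα cα sc acc) = c.val f acc + c.pairTerm f k sα cα sc := by
  unfold step pairTerm
  by_cases h : c.adm (canon (vsub sc.1 sα)) = true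
  · rw [if_pos h, if_pos h, add_zero]
  · rw [if_neg h, if_neg h]
    by_cases hp : c.partOf (canon (vsub sc.1 sα)) = k
    · rw [if_pos hp, if_pos hp, val_ins]; simp only [wsum, mul_zero, add_zero]
    · rw [if_neg hp, if_neg hp, add_zero]

/-- `val_diagStep` (see the module docstring). [folklore] -/
theorem val_diagStep (cα : List ℤ) (acc : List Entry) :
    c.val f (c.diagStep k cα acc) = c.val f acc + c.diagTerm f k cα := by
  unfold diagStep diagTerm
  by_cases hp : c.partOf (0, 0, 0, 0) = k
  · rw [if_pos hp, if_pos hp, val_ins]; simp only [wsum, mul_zero, add_zero]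
  · rw [if_neg hp, if_neg hp, add_zero]

/-- `innerPass_cons` (see the module docstring). [folklore] -/
theorem innerPass_cons (sα : ZVec4) (cα : List ℤ) (sc : ZVec4 × List ℤ) (rest : List (ZVec4 × List ℤ))
    (acc : List Entry) :
    c.innerPass k sα cα (sc :: rest) acc = c.innerPass k sα cα rest (c.step k sα cα sc acc) := by
  cases hs : c.step k sα cα sc acc <;> simp only [innerPass, hs]

/-- `outerPass_cons` (see the module docstring). [folklore] -/
theorem outerPass_cons (sa : ZVec4 × List ℤ) (rest : List (ZVec4 × List ℤ)) (acc : List Entry) :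
    c.outerPass k (sa :: rest) acc = c.outerPass k rest (c.innerPass k sa.1 sa.2 rest (c.diagStep k sa.2 acc)) := by
  cases hs : c.innerPass k sa.1 sa.2 rest (c.diagStep k sa.2 acc) <;> simp only [outerPass, hs]

/-- `val_innerPass` (see the module docstring). [folklore] -/
theorem val_innerPass (sα : ZVec4) (cα : List ℤ) (L : List (ZVec4 × List ℤ)) (acc : List Entry) :
    c.val f (c.innerPass k sα cα L acc) = c.val f acc + (L.map fun sc ↦ c.pairTerm f k sα cα sc).sum := by
  induction L generalizing acc with
  | nil => simp [innerPass]
  | cons sc rest ih =>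
      rw [innerPass_cons, ih, val_step, List.map_cons, List.sum_cons]; ring

/-- The triangular sum computed by the outer pass. -/
def triSum : List (ZVec4 × List ℤ) → ℝ
  | [] => 0
  | sa :: rest => c.diagTerm f k sa.2 + (rest.map fun sc ↦ c.pairTerm f k sa.1 sa.2 sc).sum + triSum rest

/-- `val_outerPass` (see the module docstring). [folklore] -/
theorem val_outerPass (L : List (ZVec4 × List ℤ)) (acc : List Entry) :
    c.val f (c.outerPass k L acc) = c.val f acc + c.triSum f k L := by
  induction L generalizing acc with
  | nil => simp [outerPass, triSum]
  | cons sa rest ih =>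
      rw [outerPass_cons, ih, val_innerPass, val_diagStep, triSum]; ring

/-- **Value of the table of part `k`.** -/
theorem val_table :
    c.val f (c.table k) =
      (c.witems.map fun w ↦ if c.partOf (uvec w.1 w.2.1) = k then
        2 * c.wt w * ∫ x, f (x - c.phi (uvec w.1 w.2.1)) * f x else 0).sum + c.triSum f k c.mc := by
  rw [table, val_outerPass, val_windowEntries]; simp [val]

/-- The bound: `val L ≤ tableBound L · ∫ f²`, given the bracket facts and `|X γ| ≤ X 0 = ∫ f²`. -/
theorem val_le_tableBound (hh : c.hintsOK = true) (hl : c.logsOK = true)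
    (hX0 : (∫ x, f (x - c.phi (0, 0, 0, 0)) * f x) = ∫ x, f x ^ 2)
    (hXle : ∀ γ : ZVec4, |∫ x, f (x - c.phi γ) * f x| ≤ ∫ x, f x ^ 2)
    (L : List Entry) (hL : ∀ en ∈ L, ∀ w ∈ en.2.2, c.witemOK w = true) :
    c.val f L ≤ (c.tableBound L : ℝ) * ∫ x, f x ^ 2 := by
  have hE : 0 ≤ ∫ x, f x ^ 2 := integral_nonneg fun x ↦ sq_nonneg _
  induction L with
  | nil => simp [val, tableBound]
  | cons en rest ih =>
      obtain ⟨γ, v, ws⟩ := en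
      have hws : ∀ w ∈ ws, c.witemOK w = true := fun w hw ↦ hL (γ, v, ws) (by simp) w hw
      have ih' := ih fun en hen ↦ hL en (List.mem_cons_of_mem _ hen)
      obtain ⟨hwlo, hwhi⟩ := wsum_bracket hh hl hws
      rw [show c.val f ((γ, v, ws) :: rest) =
          ((v : ℝ) / (4 : ℝ) ^ c.kbits + 2 * c.wsum ws) * (∫ x, f (x - c.phi γ) * f x) + c.val f rest from rfl,
        show c.tableBound ((γ, v, ws) :: rest) =
          c.entryBound (γ, v, ws) + c.tableBound rest from rfl,
        Rat.cast_add, add_mul (c.entryBound (γ, v, ws) : ℝ)]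
      refine add_le_add ?_ ih'
      simp only [entryBound]
      by_cases hz : γ = (0, 0, 0, 0)
      · rw [if_pos hz, hz, hX0]; push_cast
        exact mul_le_mul_of_nonneg_right (by linarith) hE
      · rw [if_neg hz]; push_cast
        set t : ℝ := (v : ℝ) / (4 : ℝ) ^ c.kbits + 2 * c.wsum ws
        calc t * (∫ x, f (x - c.phi γ) * f x) ≤ |t * ∫ x, f (x - c.phi γ) * f x| := le_abs_self _
          _ = |t| * |∫ x, f (x - c.phi γ) * f x| := abs_mul _ _
          _ ≤ |t| * ∫ x, f x ^ 2 := mul_le_mul_of_nonneg_left (hXle γ) (abs_nonneg _)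
          _ ≤ (max |2 * (c.wLoSum ws : ℝ) + (v : ℝ) / (4 : ℝ) ^ c.kbits|
                |2 * (c.wHiSum ws : ℝ) + (v : ℝ) / (4 : ℝ) ^ c.kbits|) * ∫ x, f x ^ 2 := by
              refine mul_le_mul_of_nonneg_right ?_ hE
              exact abs_le_max_abs_abs (by simp only [t]; linarith) (by simp only [t]; linarith)

end Table

/-! ### Summing the parts: the full symmetric pair sum appears -/

section Parts

variable (c) (f : ℝ → ℝ)

/-- `list_sum_finset_sum_comm` (see the module docstring). [folklore] -/
theorem list_sum_finset_sum_comm {σ : Type*} (L : List σ) (s : Finset ℕ) (g : ℕ → σ → ℝ) :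
    ∑ k ∈ s, (L.map (g k)).sum = (L.map fun x ↦ ∑ k ∈ s, g k x).sum := by
  induction L with
  | nil => simp
  | cons a rest ih => simp only [List.map_cons, List.sum_cons, Finset.sum_add_distrib, ih]

/-- `sum_ite_partOf` (see the module docstring). [folklore] -/
theorem sum_ite_partOf (hn : 0 < c.nparts) (γ : ZVec4) (t : ℝ) :
    ∑ k ∈ Finset.range c.nparts, (if c.partOf γ = k then t else 0) = t := by
  rw [Finset.sum_ite_eq]
  have : c.partOf γ ∈ Finset.range c.nparts := Finset.mem_range.2 (Nat.mod_lt _ hn)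
  rw [if_pos this]

/-- Summed over the parts, the pair term is the doubled full term (admissible classes contribute `0` on both
sides because their correlation vanishes). -/
theorem sum_pairTerm (hn : 0 < c.nparts)
    (hXadm : ∀ γ : ZVec4, c.adm γ = true → (∫ x, f (x - c.phi γ) * f x) = 0)
    (sa sc : ZVec4 × List ℤ) :
    ∑ k ∈ Finset.range c.nparts, c.pairTerm f k sa.1 sa.2 sc = 2 * c.fullTerm f sa sc := by
  unfold pairTerm fullTerm
  by_cases h : c.adm (canon (vsub sc.1 sa.1)) = true
  · simp only [h, ↓reduceIte, Finset.sum_const_zero]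
    have h0 := hXadm _ h
    rw [corr_canon] at h0
    rw [h0]; ring
  · simp only [h, Bool.false_eq_true, ↓reduceIte]
    rw [sum_ite_partOf c hn, corr_canon]
    push_cast; ring

/-- `sum_diagTerm` (see the module docstring). [folklore] -/
theorem sum_diagTerm (hn : 0 < c.nparts) (sa : ZVec4 × List ℤ) :
    ∑ k ∈ Finset.range c.nparts, c.diagTerm f k sa.2 = c.fullTerm f sa sa := by
  unfold diagTerm fullTerm
  rw [sum_ite_partOf c hn]
  have : vsub sa.1 sa.1 = (0, 0, 0, 0) := by simp [vsub]
  rw [this]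

/-- Diagonal + twice the upper triangle of the full pair terms. -/
def trid : List (ZVec4 × List ℤ) → ℝ
  | [] => 0
  | sa :: rest => c.fullTerm f sa sa + (rest.map fun sc ↦ 2 * c.fullTerm f sa sc).sum + trid rest

/-- Symmetric completion: diagonal + twice the upper triangle = the full double sum. -/
theorem triangle_eq_double : ∀ (L : List (ZVec4 × List ℤ)),
    c.trid f L = (L.map fun sa ↦ (L.map fun sc ↦ c.fullTerm f sa sc).sum).sum
  | [] => by simp [trid]
  | sa :: rest => by
      rw [trid, triangle_eq_double rest]
      simp only [List.map_cons, List.sum_cons]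
      have h1 : (rest.map fun a ↦ c.fullTerm f a sa + (rest.map fun sc ↦ c.fullTerm f a sc).sum).sum =
          (rest.map fun a ↦ c.fullTerm f sa a).sum +
            (rest.map fun a ↦ (rest.map fun sc ↦ c.fullTerm f a sc).sum).sum := by
        rw [← List.sum_map_add]
        refine congrArg List.sum (List.map_congr_left fun a _ ↦ ?_)
        rw [fullTerm_symm c f a sa]
      have h2 : (rest.map fun sc ↦ 2 * c.fullTerm f sa sc).sum = 2 * (rest.map fun sc ↦ c.fullTerm f sa sc).sum := by
        rw [List.sum_map_mul_left]
      rw [h1, h2]; ring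

/-- `sum_triSum` (see the module docstring). [folklore] -/
theorem sum_triSum (hn : 0 < c.nparts)
    (hXadm : ∀ γ : ZVec4, c.adm γ = true → (∫ x, f (x - c.phi γ) * f x) = 0) :
    ∀ (L : List (ZVec4 × List ℤ)),
      ∑ k ∈ Finset.range c.nparts, c.triSum f k L = c.trid f L
  | [] => by simp [triSum, trid]
  | sa :: rest => by
      simp only [triSum, trid, Finset.sum_add_distrib]
      rw [sum_triSum hn hXadm rest, sum_diagTerm c f hn, list_sum_finset_sum_comm]
      congr 2
      refine congrArg List.sum (List.map_congr_left fun sc _ ↦ ?_)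
      exact sum_pairTerm c f hn hXadm sa sc

end Parts

/-- `Σ_{k < |l|} l[k] = Σ l` (with `getD`), cast to `ℝ`. -/
theorem sum_range_getD_eq_sum : ∀ (l : List ℚ),
    ∑ k ∈ Finset.range l.length, ((l.getD k 0 : ℚ) : ℝ) = ((l.sum : ℚ) : ℝ)
  | [] => by simp
  | q :: qs => by
      rw [List.length_cons, Finset.sum_range_succ', List.sum_cons]
      simp only [List.getD_cons_succ, List.getD_cons_zero]
      rw [sum_range_getD_eq_sum qs, Rat.cast_add, add_comm]

/-! ### The main theorem -/

/-- **Soundness of the joint-phantom shift certificate (whole-line form).**  If `c.check = true` and every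
part check `c.checkPart k = true` (`k < nparts`), then for every `a ≤ c.aQ` and every real measurable bounded
`f` vanishing off `[−a, a]`,
`Σ_{(j,e) window items} 2 · (log p_j/√(p_j^e)) · ∫ f(x − e log p_j) f(x) dx ≤ D · ∫ f²`. -/
theorem sound_real (c : Cert) (hc : c.check = true) (hparts : ∀ k < c.nparts, c.checkPart k = true)
    {a : ℝ} (ha : a ≤ c.aQ) {f : ℝ → ℝ} (hf : Measurable f) {C : ℝ} (hC : ∀ x, |f x| ≤ C)
    (hsupp : ∀ x, x ∉ Icc (-a) a → f x = 0) :
    (c.witems.map fun w ↦ 2 * (Real.log (c.pj w.1) / Real.sqrt ((c.pj w.1 : ℝ) ^ w.2.1)) *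
        ∫ x, f (x - (w.2.1 : ℝ) * Real.log (c.pj w.1)) * f x).sum
      ≤ (c.D : ℝ) * ∫ x, f x ^ 2 := by
  -- unpack the checker
  simp only [check, Bool.and_eq_true, decide_eq_true_eq] at hc
  obtain ⟨⟨⟨⟨⟨⟨⟨⟨hh, hl⟩, _⟩, hwin⟩, hcols⟩, hden⟩, hn⟩, hlenp⟩, hD⟩ := hc
  have hwin' := windowOK_spec hwin
  have hE : 0 ≤ ∫ x, f x ^ 2 := integral_nonneg fun x ↦ sq_nonneg _
  -- facts about the correlations
  have hX0 : (∫ x, f (x - c.phi (0, 0, 0, 0)) * f x) = ∫ x, f x ^ 2 := by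
    rw [phi_zero]; exact shiftCorr_zero f
  have hXle : ∀ γ : ZVec4, |∫ x, f (x - c.phi γ) * f x| ≤ ∫ x, f x ^ 2 :=
    fun γ ↦ abs_shiftCorr_le hf hC hsupp _
  have hXadm : ∀ γ : ZVec4, c.adm γ = true → (∫ x, f (x - c.phi γ) * f x) = 0 := fun γ hγ ↦
    shiftCorr_eq_zero_of_lt_abs hsupp (two_mul_lt_abs_phi_of_adm hh hl hden hγ ha)
  -- per part: value ≤ claimed bound
  have hpart : ∀ k < c.nparts, c.val f (c.table k) ≤ (c.dparts.getD k 0 : ℝ) * ∫ x, f x ^ 2 := by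
    intro k hk
    obtain ⟨hatt, hbd⟩ := tableCheck_spec (hparts k hk)
    rw [zero_add] at hbd
    have h1 := val_le_tableBound c f hh hl hX0 hXle (c.table k) hatt
    exact h1.trans (mul_le_mul_of_nonneg_right (by exact_mod_cast hbd) hE)
  -- sum over the parts
  have hsum : ∑ k ∈ Finset.range c.nparts, c.val f (c.table k) =
      (c.witems.map fun w ↦ 2 * c.wt w * ∫ x, f (x - c.phi (uvec w.1 w.2.1)) * f x).sum +
        c.trid f c.mc := by
    simp only [val_table, Finset.sum_add_distrib]
    rw [sum_triSum c f hn hXadm, list_sum_finset_sum_comm]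
    congr 1
    refine congrArg List.sum (List.map_congr_left fun w _ ↦ ?_)
    exact sum_ite_partOf c hn _ _
  have hpos : 0 ≤ c.trid f c.mc := by
    rw [triangle_eq_double]; exact pairSum_nonneg c hcols hf hC hsupp
  -- the window part is the target
  have hT : (c.witems.map fun w ↦ 2 * c.wt w * ∫ x, f (x - c.phi (uvec w.1 w.2.1)) * f x).sum =
      (c.witems.map fun w ↦ 2 * (Real.log (c.pj w.1) / Real.sqrt ((c.pj w.1 : ℝ) ^ w.2.1)) *
        ∫ x, f (x - (w.2.1 : ℝ) * Real.log (c.pj w.1)) * f x).sum := by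
    refine congrArg List.sum (List.map_congr_left fun w hw ↦ ?_)
    have hj := (witemOK_spec (hwin' w hw)).1
    rw [phi_uvec c hj]
    simp only [wt]; push_cast; ring
  -- Σ_k dparts[k] ≤ D
  have hsumD : ∑ k ∈ Finset.range c.nparts, (c.dparts.getD k 0 : ℝ) ≤ (c.D : ℝ) := by
    have h1 : ∑ k ∈ Finset.range c.nparts, (c.dparts.getD k 0 : ℝ) = ((c.dparts.sum : ℚ) : ℝ) := by
      rw [← hlenp, sum_range_getD_eq_sum]
    rw [h1, ← qsum_eq_sum]
    exact_mod_cast hD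
  have hle : ∑ k ∈ Finset.range c.nparts, c.val f (c.table k) ≤ (c.D : ℝ) * ∫ x, f x ^ 2 := by
    calc ∑ k ∈ Finset.range c.nparts, c.val f (c.table k)
        ≤ ∑ k ∈ Finset.range c.nparts, (c.dparts.getD k 0 : ℝ) * ∫ x, f x ^ 2 :=
          Finset.sum_le_sum fun k hk ↦ hpart k (Finset.mem_range.1 hk)
      _ = (∑ k ∈ Finset.range c.nparts, (c.dparts.getD k 0 : ℝ)) * ∫ x, f x ^ 2 := by
          rw [Finset.sum_mul]
      _ ≤ (c.D : ℝ) * ∫ x, f x ^ 2 := mul_le_mul_of_nonneg_right hsumD hE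
  rw [← hT]
  linarith [hsum, hpos, hle]

end Cert

end JointSOS

end Summit.RiemannHypothesis.RiemannHypothesis.Theorems.WeilFormatC
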